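import Mathlib
import Summits.Ventures.PercRepro2.Defs
import Summits.Ventures.PercRepro2.Graph
import Summits.Ventures.PercRepro2.OneColourSwitch
import Summits.Ventures.PercRepro2.M9LoopTransfer

/-!
# Pendant and series reductions of the `m9` sign sum (blind cell PercRepro2, p3 g19, 2026-08-27)

Two exact identities for `m9SignSum` (`Σ_{Sep} σ_pq · σ_rs`, `OneColourSwitch.m9SignSum`) that
remove a non-mark of small degree, both stated on the SAME edge type: a removed edge is turned
into a LOOP at the non-mark by `Function.update` (invisible to every connection, it only doubles
the sum; the transfer lemmas are in `M9LoopTransfer`).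

* pendant (`m9SignSum_pendant`): if the non-mark `d` carries exactly one non-loop edge
  `e₀ = {d, v}`, then `m9SignSum ends = m9SignSum (update ends e₀ {d, d})`;
* series (`m9SignSum_series`): if the non-mark `d` carries exactly two non-loop edges
  `e₁ = {d, x}` and `e₂ = {d, y}`, then
  `2 · m9SignSum ends = m9SignSum ends₁ + m9SignSum ends₀`, where `ends₁` replaces `e₁` by the
  edge `{x, y}` and makes `e₂` a loop, and `ends₀` makes both loops.  (On the colourings giving
  `e₁, e₂` the same colour the vertex `d` acts as the edge `{x, y}` of that colour; on the mixed
  colourings it is a dead end in both colours.)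

The sums are split by the colour pattern on `{e₁, e₂}` and symmetrised by the flip of the loop
edge `e₂` (`flipE`).  Own work, one seat.
-/

namespace Summit.Ventures.PercRepro2

namespace M9Reduce

open OneColourSwitch

variable {V : Type*} {E : Type*}

section Sums

open Classical Finset

variable [Fintype E] [DecidableEq E]

/-- The summand of `m9SignSum`: `1_Sep · σ_pq · σ_rs`. -/
noncomputable def ker (ends : E → Sym2 V) (p q r s : V) (ω : Config E) : ℤ :=
  if sep2 ends p q r s ω then sigma ends ω p q * sigma ends ω r s else 0

/-- `m9SignSum` is the sum of the kernel. -/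
lemma m9SignSum_eq_sum_ker (ends : E → Sym2 V) (p q r s : V) :
    m9SignSum ends p q r s = ∑ ω : Config E, ker ends p q r s ω := rfl

omit [Fintype E] [DecidableEq E] in
/-- The kernel only sees the connections among the marks, in both colours. -/
lemma ker_congr {ends ends' : E → Sym2 V} {ω ω' : Config E} {p q r s d : V}
    (hp : p ≠ d) (hq : q ≠ d) (hr : r ≠ d) (hs : s ≠ d)
    (h : ∀ a b, a ≠ d → b ≠ d → (Conn ends ω a b ↔ Conn ends' ω' a b))
    (h' : ∀ a b, a ≠ d → b ≠ d →
      (Conn ends (OneColourSwitch.compl ω) a b ↔ Conn ends' (OneColourSwitch.compl ω') a b)) :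
    ker ends p q r s ω = ker ends' p q r s ω' := by
  simp only [ker, sep2, sepY, sigma, h p q hp hq, h p r hp hr, h p s hp hs, h q r hq hr,
    h q s hq hs, h r s hr hs, h' p q hp hq, h' p r hp hr, h' p s hp hs, h' q r hq hr,
    h' q s hq hs, h' r s hr hs]

omit [Fintype E] in
/-- The kernel is invariant under recolouring a loop. -/
lemma ker_update_loop {ends : E → Sym2 V} {e₀ : E} (hd : (ends e₀).IsDiag) (p q r s : V)
    (ω : Config E) (b : Bool) : ker ends p q r s (Function.update ω e₀ b) = ker ends p q r s ω := by
  simp only [ker, sep2, sepY, sigma, conn_update_loop_iff hd, compl_update, ]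

/-- **Pendant identity.** If the only non-loop edge at the non-mark `d` is `e₀ = {d, v}`, the `m9`
sign sum is unchanged when `e₀` is made a loop: `Σ_{Sep} σ_pq σ_rs` on `G` equals the same sum on
`G` with `e₀` looped (the pendant edge is invisible to the marks; its two colours give the same
term on both sides). -/
theorem m9SignSum_pendant {ends : E → Sym2 V} {e₀ : E} {d v p q r s : V}
    (hd : ∀ e, d ∈ ends e → ¬ (ends e).IsDiag → e = e₀) (he₀ : ends e₀ = s(d, v))
    (hp : p ≠ d) (hq : q ≠ d) (hr : r ≠ d) (hs : s ≠ d) :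
    m9SignSum ends p q r s = m9SignSum (Function.update ends e₀ s(d, d)) p q r s := by
  simp only [m9SignSum_eq_sum_ker]
  refine Finset.sum_congr rfl (fun ω _ => ?_)
  exact ker_congr hp hq hr hs (fun a b ha hb => conn_pendantLoop_iff hd he₀ ha hb)
    (fun a b ha hb => conn_pendantLoop_iff hd he₀ ha hb)

/-- The flip of one edge, as a permutation of the configurations. -/
noncomputable def flipE (e₀ : E) : Equiv.Perm (Config E) :=
  Function.Involutive.toPerm (fun ω => Function.update ω e₀ (!ω e₀)) (by
    intro ω
    simp only [Function.update_self, Function.update_idem, Bool.not_not, Function.update_eq_self])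

omit [Fintype E] in
/-- The flip of `e₀`, unfolded. -/
lemma flipE_apply (e₀ : E) (ω : Config E) :
    flipE e₀ ω = Function.update ω e₀ (!ω e₀) := rfl

omit [Fintype E] in
/-- The flip of `e₂` exchanges the colour patterns «`e₁, e₂` alike» and «`e₁, e₂` different». -/
lemma flipE_same_iff {e₁ e₂ : E} (hne : e₁ ≠ e₂) (ω : Config E) :
    (flipE e₂ ω e₁ = flipE e₂ ω e₂) ↔ ¬ (ω e₁ = ω e₂) := by
  simp only [flipE_apply, Function.update_self, Function.update_of_ne hne]
  cases ω e₁ <;> cases ω e₂ <;> simp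

/-- A sum over the «alike» colourings equals the sum over the «different» ones when the summand
ignores the colour of the loop `e₂`. -/
lemma sum_same_eq_sum_mixed {ends : E → Sym2 V} {e₁ e₂ : E} (hne : e₁ ≠ e₂)
    (hd : (ends e₂).IsDiag) (p q r s : V) :
    (∑ ω : Config E, if ω e₁ = ω e₂ then ker ends p q r s ω else 0) =
      ∑ ω : Config E, if ω e₁ = ω e₂ then 0 else ker ends p q r s ω := by
  refine Fintype.sum_equiv (flipE e₂) _ _ (fun ω => ?_)
  by_cases h : ω e₁ = ω e₂
  · have hne' : ¬ (flipE e₂ ω e₁ = flipE e₂ ω e₂) := by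
      rw [flipE_same_iff hne]; exact not_not.2 h
    rw [if_pos h, if_neg hne', flipE_apply, ker_update_loop hd]
  · have heq : flipE e₂ ω e₁ = flipE e₂ ω e₂ := (flipE_same_iff hne ω).2 h
    rw [if_neg h, if_pos heq]

/-- Twice the «alike» sum is the whole sum when the summand ignores the loop `e₂`. -/
lemma sum_eq_two_mul_sum_same {ends : E → Sym2 V} {e₁ e₂ : E} (hne : e₁ ≠ e₂)
    (hd : (ends e₂).IsDiag) (p q r s : V) :
    m9SignSum ends p q r s =
      2 * ∑ ω : Config E, if ω e₁ = ω e₂ then ker ends p q r s ω else 0 := by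
  rw [m9SignSum_eq_sum_ker, two_mul]
  nth_rewrite 2 [sum_same_eq_sum_mixed hne hd]
  rw [← Finset.sum_add_distrib]
  refine Finset.sum_congr rfl (fun ω _ => ?_)
  by_cases h : ω e₁ = ω e₂ <;> simp [h]

/-- Twice the «different» sum is the whole sum when the summand ignores the loop `e₂`. -/
lemma sum_eq_two_mul_sum_mixed {ends : E → Sym2 V} {e₁ e₂ : E} (hne : e₁ ≠ e₂)
    (hd : (ends e₂).IsDiag) (p q r s : V) :
    m9SignSum ends p q r s =
      2 * ∑ ω : Config E, if ω e₁ = ω e₂ then 0 else ker ends p q r s ω := by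
  rw [sum_eq_two_mul_sum_same hne hd, sum_same_eq_sum_mixed hne hd]

/-- **Series identity.** If the non-loop edges at the non-mark `d` are exactly `e₁ = {d, x}` and
`e₂ = {d, y}`, then `2 · Σ_{Sep} σ_pq σ_rs` on `G` equals the sum on `G₁` (`e₁` replaced by the
edge `{x, y}`, `e₂` looped) plus the sum on `G₀` (both looped): on the colourings giving `e₁, e₂`
one colour `d` acts as the edge `{x, y}` of that colour, on the mixed ones it is a dead end. -/
theorem m9SignSum_series {ends : E → Sym2 V} {e₁ e₂ : E} {d x y p q r s : V} (hne : e₁ ≠ e₂)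
    (hd : ∀ e, d ∈ ends e → ¬ (ends e).IsDiag → e = e₁ ∨ e = e₂)
    (h₁ : ends e₁ = s(d, x)) (h₂ : ends e₂ = s(d, y)) (hx : x ≠ d) (hy : y ≠ d)
    (hp : p ≠ d) (hq : q ≠ d) (hr : r ≠ d) (hs : s ≠ d) :
    2 * m9SignSum ends p q r s =
      m9SignSum (Function.update (Function.update ends e₁ s(x, y)) e₂ s(d, d)) p q r s +
        m9SignSum (Function.update (Function.update ends e₁ s(d, d)) e₂ s(d, d)) p q r s := by
  set ends₁ := Function.update (Function.update ends e₁ s(x, y)) e₂ s(d, d) with hends₁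
  set ends₀ := Function.update (Function.update ends e₁ s(d, d)) e₂ s(d, d) with hends₀
  have hl₁ : (ends₁ e₂).IsDiag := by simp [hends₁]
  have hl₀ : (ends₀ e₂).IsDiag := by simp [hends₀]
  have hsplit : m9SignSum ends p q r s =
      (∑ ω : Config E, if ω e₁ = ω e₂ then ker ends₁ p q r s ω else 0) +
        ∑ ω : Config E, if ω e₁ = ω e₂ then 0 else ker ends₀ p q r s ω := by
    rw [m9SignSum_eq_sum_ker, ← Finset.sum_add_distrib]
    refine Finset.sum_congr rfl (fun ω _ => ?_)
    by_cases hc : ω e₁ = ω e₂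
    · simp only [hc, if_true, add_zero]
      have hc' : OneColourSwitch.compl ω e₁ = OneColourSwitch.compl ω e₂ := by
        simp [OneColourSwitch.compl, hc]
      exact ker_congr hp hq hr hs
        (fun a b ha hb => conn_series_same_iff hne hd h₁ h₂ hx hy hc ha hb)
        (fun a b ha hb => conn_series_same_iff hne hd h₁ h₂ hx hy hc' ha hb)
    · simp only [hc, if_false, zero_add]
      have hc' : OneColourSwitch.compl ω e₁ ≠ OneColourSwitch.compl ω e₂ := by
        simp [OneColourSwitch.compl, hc]
      exact ker_congr hp hq hr hs
        (fun a b ha hb => conn_series_mixed_iff hd h₁ h₂ hc ha hb)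
        (fun a b ha hb => conn_series_mixed_iff hd h₁ h₂ hc' ha hb)
  rw [hsplit, sum_eq_two_mul_sum_same hne hl₁, sum_eq_two_mul_sum_mixed hne hl₀]
  ring

end Sums

end M9Reduce

end Summit.Ventures.PercRepro2
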